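import Literature.AnabelianGeometry.EtaleTheta.Discharge.Sec3CuspidallyPureOfPfImage

/-!
# [EtTh] Def. 3.6 (v) "cuspidally pure", TWO-SIDED AND HYPOTHESIS-FREE, at the tempered Frobenioid of the `Ÿ`-skeleton WITH CUSPS
# over the genuine connected base `B^temp(Π^tp_X)⁰` (abc-iut-L2-t3's Tate tower v3)

S. Mochizuki, *The étale theta function and its Frobenioid-theoretic manifestations*, Publ. RIMS **45** (2009)
[MochizukiEtTh2009], Def. 3.6 (v) p. 304 (PDF p. 78): "`Φ` is *cuspidally pure* if (a) for every non-cuspidal primary element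
`x ∈ Φ(A)` … there exists `y ∈ Φ^{bs-fld}(A)` such that `x ≤ y`; (b) `Prime(Φ(A)) = Prime(Φ(A))^ncsp ∪ Prime(Φ(A))^csp` [disjoint
union]"; Def. 3.1 (i) p. 296 (PDF p. 70) (`DIV⁺ ≅ ∏` over cusps ⊔ components); Def. 3.3 (iii) / Rmk. 3.3.1 p. 299 (PDF p. 73);
Example 3.9 (iii) p. 310 (PDF p. 84): "`Φ_W^ell` is … cuspidally pure [cf. the well-known structure of the special fibers of the
'universal combinatorial coverings']"; Prop. 5.1 p. 323 (PDF p. 97).  [cite: MochizukiEtTh2009, Def 3.6 p.78]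
[cite: MochizukiEtTh2009, Ex 3.9 p.84]

abc-iut cell, block C, abc-iut-L2-lead R889 row «DEF36v-PURITY@FULL-BASE», FILE 2 (seat abc-iut-f-128, gen 5).  PROOF-ONLY companion
(0 definitions, no instance, no new `Prop`) of FILE 1 `Discharge/Sec3CuspidallyPureOfPfImage.lean` (Def. 3.6 (v) for every tempered
Frobenioid with `Φ = im(Φ₀^pf → Φ₀^rlf)` GIVEN the `Φ₀`-binder `hdom`), abc-iut-L2-t3's `Ÿ`-skeleton with cusps (`TateTowerTheta.model`:
`Cusp := ℤ × Bool`, components `ℤ`; `LogDivisorModelTateTowerTheta{,Galois,Coordinates}.lean`: `coord`, `diag`, `exists_inf`,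
`dvd_iff_toAdd_coord_le`, `cnstFn`, `divZeroHom_cnstFn_unif`) and its tempered Frobenioid `ThetaTowerTempered.temperedFrobenioid` over
`B^temp(Π^tp_X)⁰` (`TemperedFrobenioidOfTateTowerTheta.lean`).  Nothing landed is edited or restated.

WHAT IS PROVED.
* `LogDivisorModel.TateTowerTheta.dvd_diag_pow_of_isPrimary` — **the `Φ₀`-clause of Def. 3.6 (v)(a) at the `Ÿ`-skeleton**: an element
  `m ∈ Φ₀(S) = Hom_Π(S, Div⁺)` whose cusp coordinates vanish (non-cuspidal) and which is PRIMARY divides `diagᴺ = div(ϖ̈ᴺ)` for some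
  `N`.  Proof (no orbit bookkeeping): the pointwise minimum `μ := m ∧ diag ∈ Φ₀(S)` (abc-iut-L2-t3's `exists_inf`) has coordinates
  `min(mult, 1)`, is `≠ 1` and divides `m`; primality gives `m ∣ μᴺ`, i.e. every component multiplicity of `m` is `≤ N`, i.e.
  `m ≤ N·diag` coordinatewise (`dvd_iff_toAdd_coord_le`).  This is print's "well-known structure of the special fibers": a primary
  invariant effective divisor supported on components has BOUNDED multiplicity, hence is dominated by a power of `div(ϖ̈)`.
* `ThetaTowerTempered.hdom_temperedFrobenioid` — the binder `hdom` of FILE 1 DISCHARGED at the `Ÿ`-skeleton: every primary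
  non-cuspidal log-divisor over `Y_A` divides `div₀(ϖ̈ᴺ)`, `ϖ̈ᴺ ∈ F₀(Y_A)` constant.
* **`ThetaTowerTempered.isCuspidallyPure_temperedFrobenioid : (ThetaTowerTempered.temperedFrobenioid X φ R S).IsCuspidallyPure`** —
  Def. 3.6 (v) WITH NO HYPOTHESIS at the tempered Frobenioid of record WITH CUSPS over the full base `B^temp(Π^tp_X)⁰`, for every
  tempered `X` and character `φ : Π^tp_X → ℤ`: the first TWO-SIDED instance in the tree ((b): every prime of `Φ(A)` over every connected
  tempered covering is a component-orbit prime or a cusp-orbit prime, never both — FILE 1; (a): this file).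

HONEST LABEL: the `Ÿ`-skeleton is abc-iut-L2-t3's combinatorial consistency witness (NOT the formal scheme `Ÿ`); [EtTh] is refereed;
nothing here bears on [IUTchIII] Cor. 3.12 — no side is taken; typed ≠ proved for anything else.
-/

noncomputable section

namespace Literature.AnabelianGeometry.EtaleTheta

open CategoryTheory Opposite Function Literature.AlgebraicGeometry.Frobenioids Literature.AnabelianGeometry.SemiGraphs

/-! ### 1. The `Φ₀`-clause at the `Ÿ`-skeleton: primary ∧ non-cuspidal ⇒ divides a power of the diagonal -/

namespace LogDivisorModel

namespace TateTowerTheta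

open GaloisAction

variable {Γ : Type} [Group Γ] (φ : Γ →* Multiplicative ℤ) (S : Action (Type 0) Γ)

/-- **A primary element of `Φ₀(S)` with vanishing cusp coordinates divides a power of the diagonal `diag = div(ϖ̈)`**: with
`μ := m ∧ diag` (coordinates `min(mult, 1)`; `μ ≠ 1`, `μ ∣ m`), primality of `m` gives `m ∣ μᴺ`, so every component multiplicity
of `m` is `≤ N` and `m ≤ N·diag` coordinatewise. [cite: MochizukiEtTh2009, Def 3.6 p.78] -/
theorem dvd_diag_pow_of_isPrimary (m : (action φ).phiZero S)
    (hm : ∀ (s : S.V) (c : Cusp), coord φ S s (Sum.inl c) m = 1) (hprim : IsPrimary m) :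
    ∃ N : ℕ, m ∣ diag φ S ^ N := by
  obtain ⟨μ, hμm, -, hc⟩ := exists_inf φ S m (diag φ S)
  have hμ1 : μ ≠ 1 := by
    intro hμ
    apply hprim.1
    refine coord_separating φ S fun s x => ?_
    rw [map_one]
    rcases x with c | j
    · exact hm s c
    · have h := hc s (Sum.inr j)
      rw [hμ, map_one, toAdd_one, coord_diag] at h
      simp only [Sum.elim_inr, toAdd_ofAdd] at h
      apply Multiplicative.toAdd.injective
      rw [toAdd_one]
      omega
  obtain ⟨N, -, hdvd⟩ := hprim.2 μ hμ1 (Precsim.of_dvd hμm)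
  refine ⟨N, dvd_of_toAdd_coord_le φ S fun s x => ?_⟩
  have h1 := toAdd_coord_le_of_dvd φ S hdvd s x
  rw [map_pow, toAdd_pow, smul_eq_mul] at h1
  rw [map_pow, toAdd_pow, smul_eq_mul, coord_diag]
  rcases x with c | j
  · rw [hm s c, toAdd_one]
    exact Nat.zero_le _
  · have h2 := hc s (Sum.inr j)
    rw [coord_diag] at h2
    simp only [Sum.elim_inr, toAdd_ofAdd] at h2 ⊢
    rw [h2] at h1
    exact h1.trans (Nat.mul_le_mul_left _ (min_le_right _ _))

end TateTowerTheta

end LogDivisorModel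

/-! ### 2. Def. 3.6 (v) at the `Ÿ`-skeleton's tempered Frobenioid over `B^temp(Π^tp_X)⁰`, hypothesis-free -/

namespace ThetaTowerTempered

open LogDivisorModel LogDivisorModel.GaloisAction

variable {K : Type} [Field K] (X : SemiGraphs.TemperedArithmeticGroup.{0} K) (φ : X.Pi →* Multiplicative ℤ)
  (R S : ((ConnectedPart (BTemp X.Pi))ᵒᵖ ⥤ CommMonCat.{0}) → Prop)

/-- **FILE 1's binder `hdom` DISCHARGED at the `Ÿ`-skeleton**: every PRIMARY NON-CUSPIDAL log-divisor `m` over `Y_A` divides the divisor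
of a constant function — namely `div₀(ϖ̈ᴺ) = diagᴺ` (`TateTowerTheta.dvd_diag_pow_of_isPrimary`, `divZeroHom_cnstFn_unif`).
[cite: MochizukiEtTh2009, Def 3.6 p.78] -/
theorem hdom_temperedFrobenioid (A : (ConnectedPart (BTemp X.Pi))ᵒᵖ)
    (m : (dm X φ).Φ₀.obj (op ((genDiagonalBase X φ).F.obj (unop A)))) (hm : m ∈ (dm X φ).ncsp₀ _) (hprim : IsPrimary m) :
    ∃ b ∈ (dm X φ).F₀ (op ((genDiagonalBase X φ).F.obj (unop A))),
      ∃ k : (dm X φ).Φ₀.obj (op ((genDiagonalBase X φ).F.obj (unop A))),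
      (dm X φ).div₀ _ b = Algebra.GrothendieckGroup.of (m * k) := by
  -- non-cuspidal = vanishing cusp coordinates
  have hm' : ∀ (s : (gset X (unop A)).V) (c : TateTowerTheta.Cusp), TateTowerTheta.coord φ (gset X (unop A)) s (Sum.inl c) m = 1 := by
    intro s c
    have h0 : TateTowerTheta.mlt (m.1 s) (Sum.inl c) = 0 := hm s c
    change Multiplicative.ofAdd (TateTowerTheta.mlt (m.1 s) (Sum.inl c)).toNat = 1
    rw [h0]
    rfl
  obtain ⟨N, k, hk⟩ := TateTowerTheta.dvd_diag_pow_of_isPrimary φ (gset X (unop A)) m hm' hprim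
  refine ⟨TateTowerTheta.cnstFn φ (gset X (unop A)) TateTowerTheta.unif ⟨rfl, rfl⟩ ^ N,
    pow_mem (TateTowerTheta.cnstFn_mem_fZero φ _ _ _) N, k, ?_⟩
  have h0 : (dm X φ).div₀ (op ((genDiagonalBase X φ).F.obj (unop A)))
      (TateTowerTheta.cnstFn φ (gset X (unop A)) TateTowerTheta.unif ⟨rfl, rfl⟩) =
      Algebra.GrothendieckGroup.of (TateTowerTheta.diag φ (gset X (unop A))) :=
    TateTowerTheta.divZeroHom_cnstFn_unif φ
  have h1 : (dm X φ).div₀ (op ((genDiagonalBase X φ).F.obj (unop A)))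
      (TateTowerTheta.cnstFn φ (gset X (unop A)) TateTowerTheta.unif ⟨rfl, rfl⟩ ^ N) =
      (dm X φ).div₀ (op ((genDiagonalBase X φ).F.obj (unop A)))
        (TateTowerTheta.cnstFn φ (gset X (unop A)) TateTowerTheta.unif ⟨rfl, rfl⟩) ^ N :=
    map_pow _ _ N
  rw [h1, h0]
  exact (map_pow Algebra.GrothendieckGroup.of (TateTowerTheta.diag φ (gset X (unop A))) N).symm.trans (congrArg _ hk)

/-- **[EtTh] Def. 3.6 (v) — TWO-SIDED, WITH NO HYPOTHESIS — at the tempered Frobenioid of the `Ÿ`-skeleton WITH CUSPS over the genuine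
connected base `B^temp(Π^tp_X)⁰`** (abc-iut-L2-t3's `ThetaTowerTempered.temperedFrobenioid`, every tempered `X`, every character
`φ : Π^tp_X → ℤ`): (a) every non-cuspidal primary element of `Φ(A)` is bounded by a base-field-theoretic one (a root of a power of
`div(ϖ̈)`), (b) every prime of `Φ(A)` is non-cuspidal or cuspidal and not both.  Print's Example 3.9 (iii) clause "`Φ_W^ell` is …
cuspidally pure" at the model of record. [cite: MochizukiEtTh2009, Def 3.6 p.78] -/
theorem isCuspidallyPure_temperedFrobenioid : (temperedFrobenioid X φ R S).IsCuspidallyPure :=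
  isCuspidallyPure_temperedFrobenioid_of_dom X φ R S fun A m hm hprim => hdom_temperedFrobenioid X φ A m hm hprim

end ThetaTowerTempered

end Literature.AnabelianGeometry.EtaleTheta

end
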